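import Summits.QuantumFields.BalabanUV.Beta.MultiscaleDecay

/-!
# `T4Continuum.ShellMeasureDecayComplexRay` — E1∕E6 ALONG THE COMPLEX CONTRACTION RAY: the k-uniform decay of `(levelOp + P)⁻¹` for a
# COMPLEX remainder `P` with `Re z^*Pz ≥ 0` under a SITEWISE, SCALE-ADAPTED conjugation budget — the `Beta/` engine's monotone-majorant
# clause fired on the multi-region averaged MODEL operator (any covering cube family; constants `d, c, a, C, θ` only)
(cell `pub-balaban`, sub-cell `t4`, spine estimate NE7c (node U5b); NE7c ROUND-2 crew `t4-ne7c-formalise-*`, unit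
`b2b-balaban-t4-ne7c-formalise-leaf-10` gen 15; owner table `t4/b2b-balaban-t4-ne7c-p1/LEAVES-NE7c-P1.md` ROW **S121 = J6** «E1∕E6 along the complex
contraction ray» of the POST-v6 ESTIMATE LANE — OFFER O-ne7cL10g15-2 (journal l.24164), GO by owner R-ne7cp1-g37-10 (b) (l.24233); leaf-05-g12's
`ALPHA-IN-TREE-MAP.md` §3 item 2 (iii): «COMPLEXIFIED backgrounds: engine + first-order remainder budget exist, NO INSTANCE»; J1 dictionary (D7); ADDITIVE — imports `Beta.MultiscaleDecay` ONLY; [folklore]; theorems only,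
0 `def`, 0 `def … : Prop`, 0 sorry, 0 citation tags; touches NO host; moves NO census row)

HONEST FRAMING.  Finite four-torus programme, rung (B)+1 only — NOT infinite volume, NOT a mass gap, NOT the Clay problem, NOT summit
progress; (B), `BetaPertHyp`, (B^μ) not consumed.  NE7c (`T4IndicatorShell.ShellWeightBound` for the cell's expansions) is NOT PRINTED in
[Balaban 1983–89] and NOT PROVED; «NE7c ⇐ the named binders» (trigger c3).  This file is a COROLLARY of OUR `Beta/` Combes–Thomas engine
(`MultiscaleCombesThomas(Budget)`, `AccretiveCombesThomas(Budget)`, `MultiscaleDecay.hc_levelOp`, all BY NAME) about OUR torus MODEL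
operator; the remainder `P`, its accretivity `hP` and its sitewise budget `hJ` are DISPLAYED HYPOTHESES; nothing of Bałaban's is asserted,
cited or discharged; WHICH complexified operator of [Balaban1985Variational] ∕ [Balaban1985BackgroundPropagators] (3.37) the u-tuple's `𝒢`
along the contraction ray IS stays node O ∕ ROW S116 (J1).  HONEST DEPENDENCY (cell): continuum YM on T⁴ ⇐ BetaPertH ∧ nine spine
estimates (0/9 proved); BetaPertH ⇐ (D1) ∧ (D4) ∧ CAP+tail; G-an2-4 gates asym, D1 and NE2/3/4.

THE POINT.  The ONE CALL's rows E1 (`‖𝒢 V f‖ ≤ B₀‖f‖`) and E6 (decay kernels) are read along the COMPLEXIFIED block contraction: the operator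
is `A₀ + P` with `A₀` real, locally coercive (the multi-region averaged operator: gap `μ₀·n(p)⁻²` sitewise, `Beta/MultiscaleDecay`) and `P` a
complex remainder whose Hermitian real part is non-negative — e.g. ANTI-HERMITIAN, the first-order part of a complexified covariant
background (J1 (D7): entries `b∕n` across a bond of `d_n`-length `1∕n`).  The engine's monotone-majorant clause says such a `P` costs ONLY
its CONJUGATION DEFECT, sitewise: `½(expRowDefect P + expColDefect P)(e)` — for the first-order example `≍ b·κ∕n(e)²`, the SAME scale as the
gap, so the budget `≤ θ·μ₀·n(e)⁻²` is a LEVEL-FREE smallness `b·κ ≲ θ·μ₀`.  Then the decay of `MultiscaleDecay.decay_levelOp` persists with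
`μ₀ ↦ (1 − θ)·μ₀`:
* §1 ABSTRACT (any finite index type): **`norm_inv_add_le_local_of_re_nonneg`** — `A` locally conjugated-coercive with profile `μ > 0` at rate
  `κ` for the weights `d(·, j)`; `Re z^*Pz ≥ 0`; `½(expRowDefect + expColDefect)(P)(e) ≤ θ·μ_e` (`θ < 1`) ⟹ `A + P` is a unit and
  `‖(A + P)⁻¹(i,j)‖ ≤ e^{−κ·d(i,j)}∕((1 − θ)·√(μ_iμ_j))` (`conjForm_add` + `localLower_of_expDefect` + `norm_inv_apply_le_local` ∕
  `isUnit_of_localConjCoercive`).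
* §2 THE MODEL END **`decay_levelOp_add_complexRay`** — the binders of `MultiscaleDecay.decay_levelOp` (covering disjoint cube family, isometric
  `Rm`, `T`, print-size weights from above, `|c| ≤ c_max`, cell-sum coercivity `C`, `0 ≤ κ ≤ 1`, `μ₀ = C − 2d·c_max²κ² − a_max(e^{2dκ} − 1) > 0`)
  + `P hP θ hJ` with the SCALE-ADAPTED budget `½(expRowDefect + expColDefect)(P; κ, d_n(·,q))(e) ≤ θ·μ₀·n(e)⁻²` ⟹ `cmat levelOp + P` is a unit
  and **`‖(cmat levelOp + P)⁻¹(p,q)‖ ≤ e^{−κ·d_n(p,q)}·n(p)n(q)∕((1 − θ)μ₀)`** (real conjugated coercivity `hc_levelOp` → complex form by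
  `realConjForm_toMatrix'` + `localConjCoercive_of_real` → §1).
* §3 the two instances of `MultiscaleDecay` §3 carried over: **`decay_levelOp_add_complexRay_flat`** (`U = 1`, `C = min(c_min²∕(4d), a_min∕2)`)
  and **`decay_levelOp_add_complexRay_cov`** (per-cube (3.35)-shape gauge `hgauge`∕`hloss` — ROW S119 (J4)'s datum —
  `C = (1 − θ_g)·min(c_min²∕(4d), a_min∕4)`).
NOT claimed: any bound on `P` for Bałaban's operators (the budget row `hJ` is displayed, asserted by nobody); sup-norm members (the (α3)
upgrade); sectioning (`dirInv`, ROW S118∕J3).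
-/

noncomputable section

open scoped BigOperators Matrix ComplexConjugate
open Finset Function Complex Matrix

namespace Summit.QuantumFields.BalabanUV.T4Continuum.ShellMeasureDecayComplexRay

open Summit.QuantumFields.BalabanUV.Beta
open Summit.QuantumFields.BalabanUV.Beta.BoxPoincare (Box)
open Summit.QuantumFields.BalabanUV.Beta.CovariantBoxPoincare (hol)
open Summit.QuantumFields.BalabanUV.Beta.MultiscaleCoerciveTorus
open Summit.QuantumFields.BalabanUV.Beta.MultiscaleCoerciveTorusCov (multiscale_coercive_torus_cov)
open Summit.QuantumFields.BalabanUV.Beta.MultiscaleDecayBudget (siteScale one_le_siteScale)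
open Summit.QuantumFields.BalabanUV.Beta.MultiscaleDistance (sdist sdist_self)
open Summit.QuantumFields.BalabanUV.Beta.MultiscaleDecay (hc_levelOp)
open Summit.QuantumFields.BalabanUV.Beta.AccretiveCombesThomas (conjForm conjForm_add)
open Summit.QuantumFields.BalabanUV.Beta.AccretiveCombesThomasBudget (expRowDefect expColDefect)
open Summit.QuantumFields.BalabanUV.Beta.MultiscaleCombesThomas (norm_inv_apply_le_local isUnit_of_localConjCoercive)
open Summit.QuantumFields.BalabanUV.Beta.MultiscaleCombesThomasBudget (localLower_of_expDefect localConjCoercive_of_real realConjForm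
  realConjForm_toMatrix')
open Summit.QuantumFields.BalabanUV.Beta.CovariantTowerMatrix (cmat)
open Literature.MathematicalPhysics.QuantumFieldTheory.Balaban1983to89
open Literature.MathematicalPhysics.QuantumFieldTheory.Balaban1983to89.B9Thm37GluePU (bsrc btgt)
open Literature.MathematicalPhysics.QuantumFieldTheory.Balaban1983to89.B9Thm37GlueTorusCov (tblk torusComb)
open Literature.MathematicalPhysics.QuantumFieldTheory.Balaban1983to89.B9Thm37GlueTorusCovLevels (levelOp)
open B5TorusCover (UT Ctr ctrU)

/-! ## §1 Abstract: a re-nonnegative complex remainder costs only its sitewise conjugation defect -/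

section Abstract

variable {ι : Type*} [Fintype ι] [DecidableEq ι]

omit [DecidableEq ι] in
/-- **LOCAL CONJUGATED COERCIVITY SURVIVES A RE-NONNEGATIVE REMAINDER UP TO ITS SITEWISE CONJUGATION DEFECT.**  `A` locally
conjugated-coercive with profile `μ` at `(κ, ρ)`; `Re z^*Pz ≥ 0`; `½(expRowDefect + expColDefect)(P; κ, ρ)(e) ≤ θ·μ_e` ⟹ `A + P` is locally
conjugated-coercive with profile `(1 − θ)·μ` at `(κ, ρ)`. [folklore] -/
theorem localConjCoercive_add_of_re_nonneg_budget {A P : Matrix ι ι ℂ} {κ : ℝ} {ρ : ι → ℝ} {μ : ι → ℝ} {θ : ℝ}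
    (hcA : ∀ z : ι → ℂ, ∑ e, μ e * ‖z e‖ ^ 2 ≤ (conjForm A κ ρ z).re)
    (hP : ∀ z : ι → ℂ, 0 ≤ (star z ⬝ᵥ (P *ᵥ z)).re)
    (hJ : ∀ e, (expRowDefect P κ ρ e + expColDefect P κ ρ e) / 2 ≤ θ * μ e) (z : ι → ℂ) :
    ∑ e, (1 - θ) * μ e * ‖z e‖ ^ 2 ≤ (conjForm (A + P) κ ρ z).re := by
  rw [conjForm_add, Complex.add_re]
  have h1 := hcA z
  have h2 := localLower_of_expDefect P κ ρ z
  have h3 := hP z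
  have h4 : ∑ e, (expRowDefect P κ ρ e + expColDefect P κ ρ e) / 2 * ‖z e‖ ^ 2 ≤ ∑ e, θ * μ e * ‖z e‖ ^ 2 :=
    Finset.sum_le_sum fun e _ => mul_le_mul_of_nonneg_right (hJ e) (sq_nonneg _)
  have h5 : ∑ e, (1 - θ) * μ e * ‖z e‖ ^ 2 = ∑ e, μ e * ‖z e‖ ^ 2 - ∑ e, θ * μ e * ‖z e‖ ^ 2 := by
    rw [← Finset.sum_sub_distrib]
    exact Finset.sum_congr rfl fun e _ => by ring
  linarith

/-- **DECAY OF `(A + P)⁻¹` FOR A RE-NONNEGATIVE REMAINDER UNDER A SITEWISE BUDGET.**  `A` locally conjugated-coercive with profile `μ > 0` at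
rate `κ ≥ 0` for EVERY weight `d(·, j)` (`d(j,j) = 0`); `Re z^*Pz ≥ 0`; `½(expRowDefect + expColDefect)(P; κ, d(·,j))(e) ≤ θ·μ_e` for every
`j`, `θ < 1`.  Then `A + P` is a unit and `‖(A + P)⁻¹(i,j)‖ ≤ e^{−κ·d(i,j)}∕((1 − θ)·√(μ_i·μ_j))`. [folklore] -/
theorem norm_inv_add_le_local_of_re_nonneg (A P : Matrix ι ι ℂ) (d : ι → ι → ℝ) (hd0 : ∀ j, d j j = 0) {κ : ℝ} (hκ : 0 ≤ κ)
    {μ : ι → ℝ} (hμ : ∀ e, 0 < μ e) {θ : ℝ} (hθ : θ < 1)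
    (hcA : ∀ j, ∀ z : ι → ℂ, ∑ e, μ e * ‖z e‖ ^ 2 ≤ (conjForm A κ (fun e => d e j) z).re)
    (hP : ∀ z : ι → ℂ, 0 ≤ (star z ⬝ᵥ (P *ᵥ z)).re)
    (hJ : ∀ j e, (expRowDefect P κ (fun e => d e j) e + expColDefect P κ (fun e => d e j) e) / 2 ≤ θ * μ e) (i j : ι) :
    IsUnit (A + P) ∧ ‖(A + P)⁻¹ i j‖ ≤ Real.exp (-(κ * d i j)) / ((1 - θ) * Real.sqrt (μ i * μ j)) := by
  have h1θ : 0 < 1 - θ := by linarith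
  have hμ' : ∀ e, 0 < (1 - θ) * μ e := fun e => mul_pos h1θ (hμ e)
  have hc : ∀ j, ∀ z : ι → ℂ, ∑ e, (1 - θ) * μ e * ‖z e‖ ^ 2 ≤ (conjForm (A + P) κ (fun e => d e j) z).re :=
    fun j z => localConjCoercive_add_of_re_nonneg_budget (hcA j) hP (hJ j) z
  refine ⟨isUnit_of_localConjCoercive hμ' (hc i), ?_⟩
  have h := norm_inv_apply_le_local (A + P) d hd0 hκ hμ' (fun j z => hc j z) i j
  have hs : Real.sqrt ((1 - θ) * μ i * ((1 - θ) * μ j)) = (1 - θ) * Real.sqrt (μ i * μ j) := by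
    rw [show (1 - θ) * μ i * ((1 - θ) * μ j) = (1 - θ) ^ 2 * (μ i * μ j) by ring, Real.sqrt_mul (sq_nonneg _),
      Real.sqrt_sq h1θ.le]
  rwa [hs] at h

end Abstract

/-! ## §2 The MODEL END: `cmat levelOp + P` on a covering cube family -/

section Model

variable {d : ℕ} {N : Fin d → ℕ} [∀ i, NeZero (N i)] [NeZero d] {Cp J K : Type} [Fintype Cp] [DecidableEq Cp] [Fintype J] [Fintype K]
  (S : J → ℕ) (hS : ∀ l, 1 ≤ S l) (hdivS : ∀ l i, S l ∣ N i) (lvl : K → J) (zc : (k : K) → Ctr N (S (lvl k)))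

/-- **THE k-UNIFORM DECAY ALONG THE COMPLEX RAY (MODEL).**  Setting of `MultiscaleDecay.decay_levelOp` (torus `UT N`, covering pairwise-disjoint
cube family, isometric `Rm` and `T`, `a ≥ 0`, level weights supported on their cells and print-size from above, `|c| ≤ c_max`, cell-sum
coercivity `C`, `0 ≤ κ ≤ 1`, `μ₀ := C − 2d·c_max²κ² − a_max(e^{2dκ} − 1) > 0`), plus a COMPLEX remainder `P` with `Re z^*Pz ≥ 0` whose sitewise
conjugation defect along every weight `κ·d_n(·, q₁)` is at most `θ·μ₀·n(e₁)⁻²` (`θ < 1`).  Then `cmat levelOp + P` is a unit and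
`‖(cmat levelOp + P)⁻¹(p,q)‖ ≤ e^{−κ·d_n(p,q)}·n(p)·n(q)∕((1 − θ)·μ₀)`. [folklore] -/
theorem decay_levelOp_add_complexRay
    (hdisj : ∀ k k' v v', cellPt S hS hdivS lvl zc k v = cellPt S hS hdivS lvl zc k' v' → k = k')
    (hcover : ∀ x : UT N, ∃ k, ∃ v : Box d (S (lvl k)), cellPt S hS hdivS lvl zc k v = x)
    (Rm : UT N × Fin d → Cp → Cp → ℝ) (hRm : ∀ b i j, ∑ k, Rm b k i * Rm b k j = if i = j then (1 : ℝ) else 0)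
    (T : J → UT N → Cp → Cp → ℝ) (hT : ∀ l x i i', ∑ k, T l x k i * T l x k i' = if i = i' then (1 : ℝ) else 0)
    (a : J → ℝ) (ha : ∀ j, 0 ≤ a j) (ω : J → UT N → ℝ)
    (hsupp : ∀ l x, ω l (ctrU N (S l) (tblk (hS l) (hdivS l) x)) ≠ 0 → ∃ k v, lvl k = l ∧ cellPt S hS hdivS lvl zc k v = x)
    {amax : ℝ} (hamax : 0 ≤ amax)
    (hscale : ∀ k, a (lvl k) * ω (lvl k) (ctrU N (S (lvl k)) (zc k)) ^ 2 * (S (lvl k) : ℝ) ^ d ≤ amax / (S (lvl k) : ℝ) ^ 2)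
    (c : UT N × Fin d → ℝ) {cmax : ℝ} (hc : ∀ b, |c b| ≤ cmax) {C : ℝ}
    (hcoer : ∀ f : UT N × Cp → ℝ,
      C * ∑ k, ((S (lvl k) : ℝ) ^ 2)⁻¹ * ∑ v : Box d (S (lvl k)), ∑ i, f (cellPt S hS hdivS lvl zc k v, i) ^ 2 ≤
        ∑ p, f p * levelOp bsrc btgt c Rm (fun l x => ctrU N (S l) (tblk (hS l) (hdivS l) x))
          (fun l x => ω l (ctrU N (S l) (tblk (hS l) (hdivS l) x))) T a f p)
    {κ : ℝ} (hκ0 : 0 ≤ κ) (hκ1 : κ ≤ 1) (hμ : 0 < C - 2 * d * cmax ^ 2 * κ ^ 2 - amax * (Real.exp (2 * d * κ) - 1))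
    (P : Matrix (UT N × Cp) (UT N × Cp) ℂ) (hP : ∀ z, 0 ≤ (star z ⬝ᵥ (P *ᵥ z)).re) {θ : ℝ} (hθ : θ < 1)
    (hJ : ∀ q e : UT N × Cp,
      (expRowDefect P κ (fun e => sdist bsrc btgt (siteScale S hS hdivS lvl zc hcover) e.1 q.1) e +
          expColDefect P κ (fun e => sdist bsrc btgt (siteScale S hS hdivS lvl zc hcover) e.1 q.1) e) / 2 ≤
        θ * ((C - 2 * d * cmax ^ 2 * κ ^ 2 - amax * (Real.exp (2 * d * κ) - 1)) *
          ((siteScale S hS hdivS lvl zc hcover e.1 : ℝ) ^ 2)⁻¹))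
    (p q : UT N × Cp) :
    IsUnit (cmat (levelOp bsrc btgt c Rm (fun l x => ctrU N (S l) (tblk (hS l) (hdivS l) x))
        (fun l x => ω l (ctrU N (S l) (tblk (hS l) (hdivS l) x))) T a) + P) ∧
      ‖(cmat (levelOp bsrc btgt c Rm (fun l x => ctrU N (S l) (tblk (hS l) (hdivS l) x))
          (fun l x => ω l (ctrU N (S l) (tblk (hS l) (hdivS l) x))) T a) + P)⁻¹ p q‖ ≤
        Real.exp (-(κ * sdist bsrc btgt (siteScale S hS hdivS lvl zc hcover) p.1 q.1)) *
          ((siteScale S hS hdivS lvl zc hcover p.1 : ℝ) * (siteScale S hS hdivS lvl zc hcover q.1 : ℝ)) /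
          ((1 - θ) * (C - 2 * d * cmax ^ 2 * κ ^ 2 - amax * (Real.exp (2 * d * κ) - 1))) := by
  classical
  set n := siteScale S hS hdivS lvl zc hcover with hn
  set A := levelOp bsrc btgt c Rm (fun l x => ctrU N (S l) (tblk (hS l) (hdivS l) x))
    (fun l x => ω l (ctrU N (S l) (tblk (hS l) (hdivS l) x))) T a with hA
  set μ₀ := C - 2 * d * cmax ^ 2 * κ ^ 2 - amax * (Real.exp (2 * d * κ) - 1) with hμ₀
  have hn0 : ∀ x, (0 : ℝ) < n x := fun x => by exact_mod_cast one_le_siteScale S hS hdivS lvl zc hcover x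
  set μ : UT N × Cp → ℝ := fun e => μ₀ * ((n e.1 : ℝ) ^ 2)⁻¹ with hμdef
  have hμpos : ∀ e, 0 < μ e := fun e => mul_pos hμ (inv_pos.mpr (pow_pos (hn0 e.1) 2))
  set dd : UT N × Cp → UT N × Cp → ℝ := fun e e' => sdist bsrc btgt n e.1 e'.1 with hdd
  have hd0 : ∀ j, dd j j = 0 := fun j => sdist_self bsrc btgt n j.1
  -- the real conjugated coercivity of `A` (MultiscaleDecay §1) read as the complex conjugated coercivity of `cmat A`
  have hcR : ∀ j, ∀ w : UT N × Cp → ℝ, ∑ e, μ e * w e ^ 2 ≤ realConjForm (LinearMap.toMatrix' A) κ (fun e => dd e j) w := by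
    intro j w
    rw [realConjForm_toMatrix']
    have h := hc_levelOp S hS hdivS lvl zc hdisj hcover Rm hRm T hT a ha ω hsupp hamax hscale c hc hcoer hκ0 hκ1 j w
    refine le_trans (le_of_eq (Finset.sum_congr rfl fun e _ => ?_)) h
    rw [hμdef]
  have hcA : ∀ j, ∀ z : UT N × Cp → ℂ, ∑ e, μ e * ‖z e‖ ^ 2 ≤ (conjForm (cmat A) κ (fun e => dd e j) z).re :=
    fun j z => localConjCoercive_of_real _ (hcR j) z
  have hEND := norm_inv_add_le_local_of_re_nonneg (cmat A) P dd hd0 hκ0 hμpos hθ hcA hP (fun j e => hJ j e) p q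
  refine ⟨hEND.1, ?_⟩
  -- the local prefactors
  have hsqrt : Real.sqrt (μ p * μ q) = μ₀ / ((n p.1 : ℝ) * (n q.1 : ℝ)) := by
    have hp := hn0 p.1
    have hq := hn0 q.1
    have e : μ p * μ q = (μ₀ / ((n p.1 : ℝ) * (n q.1 : ℝ))) ^ 2 := by
      rw [hμdef]
      field_simp
    rw [e, Real.sqrt_sq (div_nonneg hμ.le (mul_nonneg hp.le hq.le))]
  have h2 := hEND.2
  rw [hsqrt] at h2
  have h1θ : 0 < 1 - θ := by linarith
  have hpq : 0 < (n p.1 : ℝ) * (n q.1 : ℝ) := mul_pos (hn0 p.1) (hn0 q.1)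
  calc ‖(cmat A + P)⁻¹ p q‖ ≤ Real.exp (-(κ * dd p q)) / ((1 - θ) * (μ₀ / ((n p.1 : ℝ) * (n q.1 : ℝ)))) := h2
    _ = Real.exp (-(κ * dd p q)) * ((n p.1 : ℝ) * (n q.1 : ℝ)) / ((1 - θ) * μ₀) := by
        field_simp

end Model

/-! ## §3 The two instances of `MultiscaleDecay` §3 along the complex ray -/

section Instances

variable {d : ℕ} {N : Fin d → ℕ} [∀ i, NeZero (N i)] [NeZero d] {Cp J K : Type} [Fintype Cp] [DecidableEq Cp] [Fintype J] [Fintype K]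
  (S : J → ℕ) (hS : ∀ l, 1 ≤ S l) (hdivS : ∀ l i, S l ∣ N i) (lvl : K → J) (zc : (k : K) → Ctr N (S (lvl k)))

/-- **Complex ray, `U = 1`** (`MultiscaleDecay.decay_levelOp_flat`'s setting + `P hP θ hJ`; `C = min(c_min²∕(4d), a_min∕2)`). [folklore] -/
theorem decay_levelOp_add_complexRay_flat
    (hdisj : ∀ k k' v v', cellPt S hS hdivS lvl zc k v = cellPt S hS hdivS lvl zc k' v' → k = k')
    (hcover : ∀ x : UT N, ∃ k, ∃ v : Box d (S (lvl k)), cellPt S hS hdivS lvl zc k v = x)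
    (a : J → ℝ) (ha : ∀ j, 0 ≤ a j) (ω : J → UT N → ℝ)
    (hsupp : ∀ l x, ω l (ctrU N (S l) (tblk (hS l) (hdivS l) x)) ≠ 0 → ∃ k v, lvl k = l ∧ cellPt S hS hdivS lvl zc k v = x)
    {amin amax : ℝ} (hamin : 0 ≤ amin) (hamax : 0 ≤ amax)
    (hscale_lo : ∀ k, amin / (S (lvl k) : ℝ) ^ 2 ≤ a (lvl k) * ω (lvl k) (ctrU N (S (lvl k)) (zc k)) ^ 2 * (S (lvl k) : ℝ) ^ d)
    (hscale_hi : ∀ k, a (lvl k) * ω (lvl k) (ctrU N (S (lvl k)) (zc k)) ^ 2 * (S (lvl k) : ℝ) ^ d ≤ amax / (S (lvl k) : ℝ) ^ 2)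
    (c : UT N × Fin d → ℝ) {cmin cmax : ℝ} (hcmin : 0 < cmin) (hc_lo : ∀ b, cmin ≤ |c b|) (hc_hi : ∀ b, |c b| ≤ cmax)
    {κ : ℝ} (hκ0 : 0 ≤ κ) (hκ1 : κ ≤ 1)
    (hμ : 0 < min (cmin ^ 2 / (4 * d)) (amin / 2) - 2 * d * cmax ^ 2 * κ ^ 2 - amax * (Real.exp (2 * d * κ) - 1))
    (P : Matrix (UT N × Cp) (UT N × Cp) ℂ) (hP : ∀ z, 0 ≤ (star z ⬝ᵥ (P *ᵥ z)).re) {θ : ℝ} (hθ : θ < 1)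
    (hJ : ∀ q e : UT N × Cp,
      (expRowDefect P κ (fun e => sdist bsrc btgt (siteScale S hS hdivS lvl zc hcover) e.1 q.1) e +
          expColDefect P κ (fun e => sdist bsrc btgt (siteScale S hS hdivS lvl zc hcover) e.1 q.1) e) / 2 ≤
        θ * ((min (cmin ^ 2 / (4 * d)) (amin / 2) - 2 * d * cmax ^ 2 * κ ^ 2 - amax * (Real.exp (2 * d * κ) - 1)) *
          ((siteScale S hS hdivS lvl zc hcover e.1 : ℝ) ^ 2)⁻¹))
    (p q : UT N × Cp) :
    IsUnit (cmat (levelOp bsrc btgt c (fun _ => (oneM : Cp → Cp → ℝ)) (fun l x => ctrU N (S l) (tblk (hS l) (hdivS l) x))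
        (fun l x => ω l (ctrU N (S l) (tblk (hS l) (hdivS l) x))) (fun _ _ => (oneM : Cp → Cp → ℝ)) a) + P) ∧
      ‖(cmat (levelOp bsrc btgt c (fun _ => (oneM : Cp → Cp → ℝ)) (fun l x => ctrU N (S l) (tblk (hS l) (hdivS l) x))
          (fun l x => ω l (ctrU N (S l) (tblk (hS l) (hdivS l) x))) (fun _ _ => (oneM : Cp → Cp → ℝ)) a) + P)⁻¹ p q‖ ≤
        Real.exp (-(κ * sdist bsrc btgt (siteScale S hS hdivS lvl zc hcover) p.1 q.1)) *
          ((siteScale S hS hdivS lvl zc hcover p.1 : ℝ) * (siteScale S hS hdivS lvl zc hcover q.1 : ℝ)) /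
          ((1 - θ) * (min (cmin ^ 2 / (4 * d)) (amin / 2) - 2 * d * cmax ^ 2 * κ ^ 2 - amax * (Real.exp (2 * d * κ) - 1))) :=
  decay_levelOp_add_complexRay S hS hdivS lvl zc hdisj hcover (fun _ => oneM) (fun _ i j => oneM_orth i j) (fun _ _ => oneM)
    (fun _ _ i i' => oneM_orth i i') a ha ω hsupp hamax hscale_hi c hc_hi
    (fun f => multiscale_coercive_torus_flat (Nat.one_le_iff_ne_zero.mpr (NeZero.ne d)) S hS hdivS a ha ω c hcmin hc_lo lvl zc
      hdisj hamin hscale_lo f)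
    hκ0 hκ1 hμ P hP hθ hJ p q

/-- **Complex ray, COVARIANT under a per-cube (3.35)-shape gauge** (`MultiscaleDecay.decay_levelOp_cov`'s setting + `P hP θ hJ`;
`C = (1 − θ_g)·min(c_min²∕(4d), a_min∕4)` with the gauge loss `θ_g`). [folklore] -/
theorem decay_levelOp_add_complexRay_cov
    (hdisj : ∀ k k' v v', cellPt S hS hdivS lvl zc k v = cellPt S hS hdivS lvl zc k' v' → k = k')
    (hcover : ∀ x : UT N, ∃ k, ∃ v : Box d (S (lvl k)), cellPt S hS hdivS lvl zc k v = x)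
    (Rm : UT N × Fin d → Cp → Cp → ℝ) (hRm : ∀ b i j, ∑ k, Rm b k i * Rm b k j = if i = j then (1 : ℝ) else 0)
    (a : J → ℝ) (ha : ∀ j, 0 ≤ a j) (ω : J → UT N → ℝ)
    (hsupp : ∀ l x, ω l (ctrU N (S l) (tblk (hS l) (hdivS l) x)) ≠ 0 → ∃ k v, lvl k = l ∧ cellPt S hS hdivS lvl zc k v = x)
    {amin amax : ℝ} (hamin : 0 ≤ amin) (hamax : 0 ≤ amax)
    (hscale_lo : ∀ k, amin / (S (lvl k) : ℝ) ^ 2 ≤ a (lvl k) * ω (lvl k) (ctrU N (S (lvl k)) (zc k)) ^ 2 * (S (lvl k) : ℝ) ^ d)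
    (hscale_hi : ∀ k, a (lvl k) * ω (lvl k) (ctrU N (S (lvl k)) (zc k)) ^ 2 * (S (lvl k) : ℝ) ^ d ≤ amax / (S (lvl k) : ℝ) ^ 2)
    (c : UT N × Fin d → ℝ) {cmin cmax : ℝ} (hcmin : 0 < cmin) (hc_lo : ∀ b, cmin ≤ |c b|) (hc_hi : ∀ b, |c b| ≤ cmax)
    (g : (k : K) → Box d (S (lvl k)) → Cp → Cp → ℝ)
    (hg : ∀ k v i i', ∑ k', g k v k' i * g k v k' i' = if i = i' then (1 : ℝ) else 0) (ε : K → ℝ) (hε : ∀ k, 0 ≤ ε k)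
    (hgauge : ∀ k (v : Box d (S (lvl k))) (i : Fin d) (hv : (v i : ℕ) + 1 < S (lvl k)) (u : Cp → ℝ),
      ∑ a', (∑ j, (hol Rm (g k) (fun v i _ => (cellPt S hS hdivS lvl zc k v, i)) v i hv a' j -
        if a' = j then 1 else 0) * u j) ^ 2 ≤ ε k ^ 2 * ∑ j, u j ^ 2)
    {θg : ℝ} (hloss : ∀ k, 4 * ((d : ℝ) * (S (lvl k)) * ((S (lvl k) : ℝ) - 1)) * d * ε k ^ 2 +
      4 * ((d * (S (lvl k) - 1) : ℕ) * ε k) ^ 2 ≤ θg)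
    {κ : ℝ} (hκ0 : 0 ≤ κ) (hκ1 : κ ≤ 1)
    (hμ : 0 < (1 - θg) * min (cmin ^ 2 / (4 * d)) (amin / 4) - 2 * d * cmax ^ 2 * κ ^ 2 - amax * (Real.exp (2 * d * κ) - 1))
    (P : Matrix (UT N × Cp) (UT N × Cp) ℂ) (hP : ∀ z, 0 ≤ (star z ⬝ᵥ (P *ᵥ z)).re) {θ : ℝ} (hθ : θ < 1)
    (hJ : ∀ q e : UT N × Cp,
      (expRowDefect P κ (fun e => sdist bsrc btgt (siteScale S hS hdivS lvl zc hcover) e.1 q.1) e +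
          expColDefect P κ (fun e => sdist bsrc btgt (siteScale S hS hdivS lvl zc hcover) e.1 q.1) e) / 2 ≤
        θ * (((1 - θg) * min (cmin ^ 2 / (4 * d)) (amin / 4) - 2 * d * cmax ^ 2 * κ ^ 2 - amax * (Real.exp (2 * d * κ) - 1)) *
          ((siteScale S hS hdivS lvl zc hcover e.1 : ℝ) ^ 2)⁻¹))
    (p q : UT N × Cp) :
    IsUnit (cmat (levelOp bsrc btgt c Rm (fun l x => ctrU N (S l) (tblk (hS l) (hdivS l) x))
        (fun l x => ω l (ctrU N (S l) (tblk (hS l) (hdivS l) x))) (fun l x => (torusComb (hS l) (hdivS l)).tr Rm x) a) + P) ∧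
      ‖(cmat (levelOp bsrc btgt c Rm (fun l x => ctrU N (S l) (tblk (hS l) (hdivS l) x))
          (fun l x => ω l (ctrU N (S l) (tblk (hS l) (hdivS l) x))) (fun l x => (torusComb (hS l) (hdivS l)).tr Rm x) a) + P)⁻¹
          p q‖ ≤
        Real.exp (-(κ * sdist bsrc btgt (siteScale S hS hdivS lvl zc hcover) p.1 q.1)) *
          ((siteScale S hS hdivS lvl zc hcover p.1 : ℝ) * (siteScale S hS hdivS lvl zc hcover q.1 : ℝ)) /
          ((1 - θ) * ((1 - θg) * min (cmin ^ 2 / (4 * d)) (amin / 4) - 2 * d * cmax ^ 2 * κ ^ 2 -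
            amax * (Real.exp (2 * d * κ) - 1))) :=
  decay_levelOp_add_complexRay S hS hdivS lvl zc hdisj hcover Rm hRm (fun l x => (torusComb (hS l) (hdivS l)).tr Rm x)
    (fun l x i i' => (torusComb (hS l) (hdivS l)).tr_orth Rm hRm x i i') a ha ω hsupp hamax hscale_hi c hc_hi
    (fun f => multiscale_coercive_torus_cov (Nat.one_le_iff_ne_zero.mpr (NeZero.ne d)) S hS hdivS Rm hRm a ha ω c hcmin hc_lo lvl zc
      hdisj hamin hscale_lo g hg ε hε hgauge hloss f)
    hκ0 hκ1 hμ P hP hθ hJ p q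

end Instances

end Summit.QuantumFields.BalabanUV.T4Continuum.ShellMeasureDecayComplexRay

end
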